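import Summits.CriticalPhenomena.SAWScalingLimit.Theses.SAWRestrictionRigidity
import Summits.CriticalPhenomena.SAWScalingLimit.Theorems.SAWRestrictionRigidityRigidityIffRepairAndRado
import Summits.CriticalPhenomena.SAWScalingLimit.Theorems.SAWRestrictionRigidityRigidityRadoExtensionDisc
import Summits.CriticalPhenomena.SAWScalingLimit.Theorems.SAWRestrictionRigidityRigidityDiscUniformization
import Summits.CriticalPhenomena.SAWScalingLimit.Theorems.SAWRestrictionRigidityRigidityCovarianceOfImages
import Summits.CriticalPhenomena.SAWScalingLimit.Theorems.Rigidity.Negative.RigidityFalseOfNonRadoAxiomsFamily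

/-!
# The open core of crux `Rigidity` at the reference disc is EXACTLY the repaired crux C′ — crux stmt-CriticalPhenomena-1368, line `registered` (lead c7, 2026-08-17)

Target: `Summits/CriticalPhenomena/SAWScalingLimit/Theorems/SAWRestrictionRigidityRigidityDiscCoreIffRepair.lean`
(`--supports stmt-CriticalPhenomena-1368`).

Line `registered` of crux `Rigidity` (routes SAWRestrictionRigidity r2, SAWZoomRigidity r3) is registered
(reshape v5b, `Cruxes/Rigidity/Lines/registered.lean`) with exactly two open stubs:

* `stub_discCoreAnalytic` — under the seven lattice-exact axioms and Radó continuity, the law of any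
  two-marked unit disc transports as `P D' = Φ_* P D₀` along every `Φ : C(ℂ, ℂ)` complex
  differentiable and injective on an open neighbourhood of the CLOSED disc (`D'` the Dobrushin domain
  with carrier `Φ '' 𝔻` and marks `Φ a`, `Φ b`);
* `stub_axiomsForceRado` — the seven axioms force Radó continuity (≡ `¬NonRadoAxiomsFamily`, p159714).

This file certifies, in the kernel, what promoting `stub_discCoreAnalytic` means for a planner:

* `repair_of_discCoreAnalytic` / `discCoreAnalytic_of_repair` / `discCoreAnalytic_iff_repair`: the
  stub's statement is EQUIVALENT to the repaired crux C′ (packaged form: chordal + restriction +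
  restriction–Markov + reversible + lattice-similarity covariant + simple boundary-avoiding +
  Radó-continuous ⇒ conformally covariant; = first conjunct of `Repair.rigidity_iff_repair_and_rado`,
  = body of `Cruxes/Rigidity/Repair.lean` `RigidityC` up to `Iff.rfl` packaging). `←` is one line of
  `IsConformallyCovariant.eq_map_of_image`; `→` is the landed bookkeeping chain of the line:
  Radó extension at the disc (`stub_radoExtensionDisc`, p168392) → disc uniformization
  (`stub_discUniformization`, p168637) → image covariance is conformal covariance
  (`stub_covarianceOfImages`, p168702).
* `rigidity_iff_discCoreAnalytic_and_rado`: hence the crux AS TYPED is equivalent to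
  `stub_discCoreAnalytic ∧ stub_axiomsForceRado` (through p159660) — the registered skeleton is a
  faithful cut, and restating the item as C′ (leads c3–c7) discards precisely the SAW-irrelevant
  residue `stub_axiomsForceRado`.
* `axiomsForceRado_iff_not_nonRadoAxiomsFamily`, `rigidity_iff_discCoreAnalytic_and_not_nonRadoAxiomsFamily`
  (appended): the residue stub is literally `¬NonRadoAxiomsFamily`, so the typed crux ↔ (disc core) ∧ ¬(keyed
  monster exists) — its full status in one line.
-/

namespace Summit.CriticalPhenomena.SAWScalingLimit.Cruxes.Rigidity.Dichotomy

open MeasureTheory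
open Literature.Probability.RandomPlanarGeometry

/-- **The disc core implies the repaired crux C′** (the composition of line `registered`, v5b, with its three landed bookkeeping stubs): if, under the seven lattice-exact axioms and Radó continuity, the laws of two-marked unit discs transport correctly along maps analytic and injective near the closed disc, then every such family is conformally covariant — Radó extension at the disc (p168392), disc uniformization by Riemann + Carathéodory (p168637), and image covariance = conformal covariance (p168702). [folklore] -/
theorem repair_of_discCoreAnalytic
    (hcore : ∀ P : Literature.Probability.RandomPlanarGeometry.ChordalFamily, P.IsChordal → P.IsRestriction → P.IsRestrictionMarkov → P.IsReversible → P.IsLatticeSimilarityCovariant → P.IsCarriedBySimpleCurves → P.IsRadoContinuous → ∀ (D₀ D' : Literature.Probability.RandomPlanarGeometry.DobrushinDomain) (Φ : C(ℂ, ℂ)) (U : Set ℂ), D₀.carrier = Metric.ball 0 1 → IsOpen U → closure D₀.carrier ⊆ U → DifferentiableOn ℂ Φ U → Set.InjOn Φ U → D'.carrier = Φ '' D₀.carrier → D'.pt 0 = Φ (D₀.pt 0) → D'.pt 1 = Φ (D₀.pt 1) → P D' = (P D₀).map (Literature.Probability.RandomPlanarGeometry.CurveClass.map Φ)) :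
    ∀ P : Literature.Probability.RandomPlanarGeometry.ChordalFamily, P.IsChordal → P.IsRestriction → P.IsRestrictionMarkov → P.IsReversible → P.IsLatticeSimilarityCovariant → P.IsCarriedBySimpleCurves → P.IsRadoContinuous → P.IsConformallyCovariant :=
  fun P hch hres hRM hrev hLS hS hRado =>
    stub_covarianceOfImages P
      (stub_discUniformization P
        (stub_radoExtensionDisc P hch hRado (hcore P hch hres hRM hrev hLS hS hRado)))

/-- **The repaired crux C′ implies the disc core** (one line: a conformally covariant family transports along univalent images, `IsConformallyCovariant.eq_map_of_image`; a map analytic and injective on a neighbourhood of the closed disc is so on the open disc). So the registered open stub is not STRONGER than C′. [folklore] -/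
theorem discCoreAnalytic_of_repair
    (hC : ∀ P : Literature.Probability.RandomPlanarGeometry.ChordalFamily, P.IsChordal → P.IsRestriction → P.IsRestrictionMarkov → P.IsReversible → P.IsLatticeSimilarityCovariant → P.IsCarriedBySimpleCurves → P.IsRadoContinuous → P.IsConformallyCovariant) :
    ∀ P : Literature.Probability.RandomPlanarGeometry.ChordalFamily, P.IsChordal → P.IsRestriction → P.IsRestrictionMarkov → P.IsReversible → P.IsLatticeSimilarityCovariant → P.IsCarriedBySimpleCurves → P.IsRadoContinuous → ∀ (D₀ D' : Literature.Probability.RandomPlanarGeometry.DobrushinDomain) (Φ : C(ℂ, ℂ)) (U : Set ℂ), D₀.carrier = Metric.ball 0 1 → IsOpen U → closure D₀.carrier ⊆ U → DifferentiableOn ℂ Φ U → Set.InjOn Φ U → D'.carrier = Φ '' D₀.carrier → D'.pt 0 = Φ (D₀.pt 0) → D'.pt 1 = Φ (D₀.pt 1) → P D' = (P D₀).map (Literature.Probability.RandomPlanarGeometry.CurveClass.map Φ) := by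
  intro P hch hres hRM hrev hLS hS hRado D₀ D' Φ U _ _ hcl hdiff hinj hcar h0 h1
  have hsub : D₀.carrier ⊆ U := subset_closure.trans hcl
  exact (hC P hch hres hRM hrev hLS hS hRado).eq_map_of_image (hdiff.mono hsub) (hinj.mono hsub)
    hcar h0 h1

/-- **The open stub of line `registered` IS the repaired crux C′**: `stub_discCoreAnalytic`'s statement ↔ (seven axioms + Radó continuity ⇒ conformal covariance). Kernel certificate for the planner: promoting/filing the stub as an item is the same act as restating stmt-CriticalPhenomena-1368 as C′ (`Cruxes/Rigidity/Repair.lean` `RigidityC`, deciding theorem `Repair.closesC` with the existing stmt-7305). [folklore] -/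
theorem discCoreAnalytic_iff_repair :
    (∀ P : Literature.Probability.RandomPlanarGeometry.ChordalFamily, P.IsChordal → P.IsRestriction → P.IsRestrictionMarkov → P.IsReversible → P.IsLatticeSimilarityCovariant → P.IsCarriedBySimpleCurves → P.IsRadoContinuous → ∀ (D₀ D' : Literature.Probability.RandomPlanarGeometry.DobrushinDomain) (Φ : C(ℂ, ℂ)) (U : Set ℂ), D₀.carrier = Metric.ball 0 1 → IsOpen U → closure D₀.carrier ⊆ U → DifferentiableOn ℂ Φ U → Set.InjOn Φ U → D'.carrier = Φ '' D₀.carrier → D'.pt 0 = Φ (D₀.pt 0) → D'.pt 1 = Φ (D₀.pt 1) → P D' = (P D₀).map (Literature.Probability.RandomPlanarGeometry.CurveClass.map Φ)) ↔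
    (∀ P : Literature.Probability.RandomPlanarGeometry.ChordalFamily, P.IsChordal → P.IsRestriction → P.IsRestrictionMarkov → P.IsReversible → P.IsLatticeSimilarityCovariant → P.IsCarriedBySimpleCurves → P.IsRadoContinuous → P.IsConformallyCovariant) :=
  ⟨repair_of_discCoreAnalytic, discCoreAnalytic_of_repair⟩

/-- **The crux AS TYPED ↔ (disc core) ∧ (axioms force Radó)**: composing `discCoreAnalytic_iff_repair` with the landed split `Repair.rigidity_iff_repair_and_rado` (p159660). The registered skeleton of line `registered` (v5b: stubs `stub_discCoreAnalytic`, `stub_axiomsForceRado`) is therefore a FAITHFUL cut of the typed crux — neither stub can be weakened without losing the equivalence — and its two stubs are, respectively, LSW04 §3.4.5's open problem and the SAW-irrelevant regularity residue `¬NonRadoAxiomsFamily`. [folklore] -/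
theorem rigidity_iff_discCoreAnalytic_and_rado :
    Summit.CriticalPhenomena.SAWScalingLimit.Theses.SAWRestrictionRigidity.Rigidity ↔
      ((∀ P : Literature.Probability.RandomPlanarGeometry.ChordalFamily, P.IsChordal → P.IsRestriction → P.IsRestrictionMarkov → P.IsReversible → P.IsLatticeSimilarityCovariant → P.IsCarriedBySimpleCurves → P.IsRadoContinuous → ∀ (D₀ D' : Literature.Probability.RandomPlanarGeometry.DobrushinDomain) (Φ : C(ℂ, ℂ)) (U : Set ℂ), D₀.carrier = Metric.ball 0 1 → IsOpen U → closure D₀.carrier ⊆ U → DifferentiableOn ℂ Φ U → Set.InjOn Φ U → D'.carrier = Φ '' D₀.carrier → D'.pt 0 = Φ (D₀.pt 0) → D'.pt 1 = Φ (D₀.pt 1) → P D' = (P D₀).map (Literature.Probability.RandomPlanarGeometry.CurveClass.map Φ)) ∧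
       (∀ P : Literature.Probability.RandomPlanarGeometry.ChordalFamily, P.IsChordal → P.IsRestriction → P.IsRestrictionMarkov → P.IsReversible → P.IsLatticeSimilarityCovariant → P.IsCarriedBySimpleCurves → P.IsRadoContinuous)) := by
  rw [Summit.CriticalPhenomena.SAWScalingLimit.Cruxes.Rigidity.Repair.rigidity_iff_repair_and_rado,
    discCoreAnalytic_iff_repair]

/-- **The residue stub IS the non-existence of a keyed monster**: `stub_axiomsForceRado`'s statement ("the seven lattice-exact axioms force Radó continuity") is literally `¬ NonRadoAxiomsFamily` (`Theorems/Rigidity/Negative/RigidityFalseOfNonRadoAxiomsFamily.lean`, p159714) — filing it as an item would be a bet against the disprover's construction programme (T1 ∧ T2 of `Cruxes/Rigidity/AUDIT-c5.md` §3), and no SAW route needs it. (Appended by lead c7.) [folklore] -/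
theorem axiomsForceRado_iff_not_nonRadoAxiomsFamily :
    (∀ P : Literature.Probability.RandomPlanarGeometry.ChordalFamily, P.IsChordal → P.IsRestriction → P.IsRestrictionMarkov → P.IsReversible → P.IsLatticeSimilarityCovariant → P.IsCarriedBySimpleCurves → P.IsRadoContinuous) ↔
      ¬ Summit.CriticalPhenomena.SAWScalingLimit.Theorems.Rigidity.Negative.NonRadoAxiomsFamily := by
  constructor
  · rintro h ⟨P, hch, hres, hRM, hrev, hLS, hS, hnot⟩
    exact hnot (h P hch hres hRM hrev hLS hS)
  · intro h P hch hres hRM hrev hLS hS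
    by_contra hnot
    exact h ⟨P, hch, hres, hRM, hrev, hLS, hS, hnot⟩

/-- **Status certificate of the crux AS TYPED** (lead c7): `Rigidity ↔ (disc core of C′) ∧ ¬ NonRadoAxiomsFamily` — the typed crux is exactly LSW04 §3.4.5's open problem (in the minimal, fully book-kept form `stub_discCoreAnalytic`) conjoined with the non-existence of a non-Radó-continuous family with the seven axioms. Composition of `rigidity_iff_discCoreAnalytic_and_rado` with `axiomsForceRado_iff_not_nonRadoAxiomsFamily`. [folklore] -/
theorem rigidity_iff_discCoreAnalytic_and_not_nonRadoAxiomsFamily :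
    Summit.CriticalPhenomena.SAWScalingLimit.Theses.SAWRestrictionRigidity.Rigidity ↔
      ((∀ P : Literature.Probability.RandomPlanarGeometry.ChordalFamily, P.IsChordal → P.IsRestriction → P.IsRestrictionMarkov → P.IsReversible → P.IsLatticeSimilarityCovariant → P.IsCarriedBySimpleCurves → P.IsRadoContinuous → ∀ (D₀ D' : Literature.Probability.RandomPlanarGeometry.DobrushinDomain) (Φ : C(ℂ, ℂ)) (U : Set ℂ), D₀.carrier = Metric.ball 0 1 → IsOpen U → closure D₀.carrier ⊆ U → DifferentiableOn ℂ Φ U → Set.InjOn Φ U → D'.carrier = Φ '' D₀.carrier → D'.pt 0 = Φ (D₀.pt 0) → D'.pt 1 = Φ (D₀.pt 1) → P D' = (P D₀).map (Literature.Probability.RandomPlanarGeometry.CurveClass.map Φ)) ∧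
       ¬ Summit.CriticalPhenomena.SAWScalingLimit.Theorems.Rigidity.Negative.NonRadoAxiomsFamily) := by
  rw [rigidity_iff_discCoreAnalytic_and_rado, axiomsForceRado_iff_not_nonRadoAxiomsFamily]

end Summit.CriticalPhenomena.SAWScalingLimit.Cruxes.Rigidity.Dichotomy
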